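import Literature.IUT.LogVolume.MultiradialRegionInd1Bound
import Mathlib.Tactic.Positivity
import HarnessLib

/-!
# The hull of the (Ind1)-union is bounded BELOW by the least-divisible-slot value — globally
# (tensor powers, `ln ν̄_{𝕃_p}`, `ln ν̄_𝕃`), for every packet model with indeterminacies

PROOF-ONLY sequel to abc-iut-c312-d1's `MultiradialRegionInd1Bound.lean` (per-summand statement
`lnAbs_le_logμ_hullUTheta_of_slot`: for every slot `k` of a collection `v⃗`, `ln|t_{j,v⃗(k)}|_p ≤
log μ̄_{v⃗}(hull(U_Θ)_{v⃗})`). Dupuy–Hilado, *The statement of Mochizuki's Corollary 3.12*, arXiv:2004.13228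
[DupuyHilado2025]: §3.6 / Def. 3.6.3 (`ln ν̄_{𝔸^{⊗ j+1}} = Σ_{v⃗} log μ̄_{v⃗}(−)·Π_k Pr(v⃗(k))`, `ln ν̄_{𝕃_p} = (1/ℓ⋇)Σ_j`,
`ln ν̄_𝕃 = Σ_p`), §3.9 (the region `O_𝕃(−div t)`: twist at the LAST slot), §4.7 ((Ind1) = permutations of the
tensor factors), §4.11–4.12 (`U_Θ`, `hull`); S. Mochizuki, *IUT IV* [Mochizuki2012], proof of Thm. 1.10 Step (v)
p. 27–28 (the gain "`λ`" read at "`i† = j`", then "symmetrized").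

WHAT IS PROVED (abc-iut cell, campaign-S seat abc-iut-S8; elementary consequences of the typed definitions):
for an `IndPacketModel M`, an lgp-idele `t`, an (Ind3)-datum `D` whose hull `hull(U_Θ)` has admissible
components, and any bookkeeping `θ` of the sizes `ln|t_{j,v}|_p = −θ_j(v)`:
* `neg_inf_le_logμ_hullUTheta` — per collection `v⃗`: `−min_k θ_j(v⃗(k)) ≤ log μ̄_{v⃗}(hull(U_Θ)_{v⃗})`;
* `neg_slotMin_le_lnνTensorPower_hullUTheta`, `…_lnνLp_…`, `neg_slotMin_le_lnνL_hullUTheta` — the weighted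
  (`Π_k Pr(v⃗(k))`), procession-averaged (`1/ℓ⋇`) and `p`-summed forms:
  `−Σ_{p∈T}(1/ℓ⋇)Σ_jΣ_{v⃗}(min_k θ_j(v⃗(k)))·Π_k Pr(v⃗(k)) ≤ ln ν̄_𝕃(hull(U_Θ))`;
* `lnνL_region_eq_neg_lastSlot` — for comparison, Thm. 3.10.1's value of the BARE region:
  `ln ν̄_𝕃(O_𝕃(−div t)) = −Σ_{p∈T}(1/ℓ⋇)Σ_jΣ_{v⃗} θ_j(v⃗(j))·Π_k Pr(v⃗(k))` (gain at the LAST slot).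
Hence any `δ` with `ln ν̄_𝕃(hull(U_Θ)) ≤ ln ν̄_𝕃(O_𝕃(−div t)) + δ` satisfies
`δ ≥ Σ_{p∈T}(1/ℓ⋇)Σ_jΣ_{v⃗}(θ_j(v⃗(j)) − min_k θ_j(v⃗(k)))·Π_k Pr(v⃗(k))` (`slotResidue_le_of_hull_le`) — the
summit-side file `LDHSlotResidue.lean` reads this on Dupuy–Hilado data, on abc-iut-S2's genuine Θ-volume inputs
and at the `λ`-line (the pilot-data quantity is `PilotData.slotResidue` of `PilotSlotResidue.lean`).
Nothing here takes a side on [IUTchIII] Cor. 3.12 or asserts anything about [IUTchIV] Thm. 1.10 beyond the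
displayed consequences of the typed definitions ((Ind1) as typed from Dupuy–Hilado §4.7); typed ≠ endorsed.
-/

noncomputable section

namespace Literature.IUT.LogVolume

namespace IndPacketModel

open Finset NumberField

variable {F : Type*} [Field F] [NumberField F] (M : IndPacketModel F)
variable {lstar : ℕ} {t : M.LgpIdele lstar} (D : M.Ind3Datum t)
variable (θ : Fin lstar → (p : ℕ) → placesOver F p → ℝ)

/-- **Per collection.** If `ln|t_{j,v}|_p = −θ_j(v)` and the `v⃗`-component of `hull(U_Θ)` is admissible,
then `−min_k θ_j(v⃗(k)) ≤ log μ̄_{v⃗}(hull(U_Θ)_{v⃗})` (degree `j = i+1`): every slot's value is a lower bound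
(c312-d1's `lnAbs_le_logμ_hullUTheta_of_slot`), hence so is the largest, `−min_k θ_j(v⃗(k))`.
[cite: DupuyHilado2025, §4.7, §4.11, §4.12] -/
theorem neg_inf_le_logμ_hullUTheta (hθ : ∀ i p v, M.lnAbs (t i p v) = -θ i p v)
    (p : ℕ) (i : Fin lstar) (e : Fin ((i : ℕ) + 1 + 1) → placesOver F p)
    (hH : M.adm (M.hullUTheta D p ((i : ℕ) + 1) e)) :
    -(Finset.univ.inf' Finset.univ_nonempty (fun k => θ i p (e k))) ≤
      M.logμ (M.hullUTheta D p ((i : ℕ) + 1) e) := by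
  rw [neg_le]
  refine Finset.le_inf' _ _ fun k _ => ?_
  have hk := M.lnAbs_le_logμ_hullUTheta_of_slot D p i e k hH
  rw [hθ] at hk
  linarith

/-- The product weight of a collection is nonnegative. [cite: DupuyHilado2025, §3.6] -/
private theorem prod_weight_nonneg' {p n : ℕ} (e : Fin n → placesOver F p) :
    0 ≤ ∏ k, weight F (e k).1 :=
  Finset.prod_nonneg fun k _ => weight_nonneg F (e k).1

/-- **Tensor-power form**: `−Σ_{v⃗∈V(F)_p^{j+1}} (min_k θ_j(v⃗(k)))·Π_k Pr(v⃗(k)) ≤ ln ν̄_{𝔸^{⊗ j+1}_{V̲,p}}(hull(U_Θ))`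
(weights `Π_k Pr(v⃗(k)) ≥ 0`, Dupuy–Hilado §3.6). [cite: DupuyHilado2025, §3.6, §4.12] -/
theorem neg_slotMin_le_lnνTensorPower_hullUTheta (hθ : ∀ i p v, M.lnAbs (t i p v) = -θ i p v)
    (p : ℕ) (i : Fin lstar) (hH : ∀ e, M.adm (M.hullUTheta D p ((i : ℕ) + 1) e)) :
    -(∑ e : Fin ((i : ℕ) + 1 + 1) → placesOver F p,
        Finset.univ.inf' Finset.univ_nonempty (fun k => θ i p (e k)) * ∏ k, weight F (e k).1) ≤
      M.lnνTensorPower p ((i : ℕ) + 1) (M.hullUTheta D) := by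
  rw [PacketModel.lnνTensorPower, ← Finset.sum_neg_distrib]
  refine Finset.sum_le_sum fun e _ => ?_
  rw [← neg_mul]
  exact mul_le_mul_of_nonneg_right (M.neg_inf_le_logμ_hullUTheta D θ hθ p i e (hH e))
    (prod_weight_nonneg' e)

/-- **Procession-averaged form at `p`**: `−(1/ℓ⋇)Σ_jΣ_{v⃗}(min_k θ_j(v⃗(k)))·Π_k Pr(v⃗(k)) ≤ ln ν̄_{𝕃_p}(hull(U_Θ))`.
[cite: DupuyHilado2025, Def. 3.6.3, §4.12] -/
theorem neg_slotMin_le_lnνLp_hullUTheta (hθ : ∀ i p v, M.lnAbs (t i p v) = -θ i p v) (p : ℕ)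
    (hH : ∀ (i : Fin lstar) e, M.adm (M.hullUTheta D p ((i : ℕ) + 1) e)) :
    -((1 / (lstar : ℝ)) * ∑ i : Fin lstar, ∑ e : Fin ((i : ℕ) + 1 + 1) → placesOver F p,
        Finset.univ.inf' Finset.univ_nonempty (fun k => θ i p (e k)) * ∏ k, weight F (e k).1) ≤
      M.lnνLp lstar p (M.hullUTheta D) := by
  rw [PacketModel.lnνLp, ← mul_neg, ← Finset.sum_neg_distrib]
  refine mul_le_mul_of_nonneg_left (Finset.sum_le_sum fun i _ => ?_) (by positivity)
  exact M.neg_slotMin_le_lnνTensorPower_hullUTheta D θ hθ p i (hH i)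

/-- **Global form**: for every finite set of indices `T`,
`−Σ_{p∈T}(1/ℓ⋇)Σ_jΣ_{v⃗}(min_k θ_j(v⃗(k)))·Π_k Pr(v⃗(k)) ≤ ln ν̄_𝕃(hull(U_Θ))` — the hull of the UNION of the
(Ind1)-permuted regions is bounded below, globally, by the least-divisible-slot aggregate.
[cite: DupuyHilado2025, Def. 3.6.3, §4.7, §4.11, §4.12] -/
theorem neg_slotMin_le_lnνL_hullUTheta (hθ : ∀ i p v, M.lnAbs (t i p v) = -θ i p v)
    (hH : M.RegionAdm (M.hullUTheta D)) (T : Finset ℕ) :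
    -(∑ p ∈ T, (1 / (lstar : ℝ)) * ∑ i : Fin lstar, ∑ e : Fin ((i : ℕ) + 1 + 1) → placesOver F p,
        Finset.univ.inf' Finset.univ_nonempty (fun k => θ i p (e k)) * ∏ k, weight F (e k).1) ≤
      M.lnνL lstar T (M.hullUTheta D) := by
  rw [PacketModel.lnνL, ← Finset.sum_neg_distrib]
  exact Finset.sum_le_sum fun p _ => M.neg_slotMin_le_lnνLp_hullUTheta D θ hθ p fun i e => hH p _ e

/-- **The bare region, for comparison** (Dupuy–Hilado Thm. 3.10.1 unfolded with the bookkeeping `θ`):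
`ln ν̄_𝕃(O_𝕃(−div t)) = −Σ_{p∈T}(1/ℓ⋇)Σ_jΣ_{v⃗} θ_j(v⃗(j))·Π_k Pr(v⃗(k))` — the gain read at the LAST slot `i† = j`
of each collection, exactly as in [IUTchIV] Thm. 1.10 Step (v). [cite: DupuyHilado2025, §3.9, Thm. 3.10.1] -/
theorem lnνL_region_eq_neg_lastSlot (hθ : ∀ i p v, M.lnAbs (t i p v) = -θ i p v) (T : Finset ℕ) :
    M.lnνL lstar T (M.region t) =
      -(∑ p ∈ T, (1 / (lstar : ℝ)) * ∑ i : Fin lstar, ∑ e : Fin ((i : ℕ) + 1 + 1) → placesOver F p,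
        θ i p (e (Fin.last _)) * ∏ k, weight F (e k).1) := by
  rw [PacketModel.lnνL, ← Finset.sum_neg_distrib]
  refine Finset.sum_congr rfl fun p _ => ?_
  rw [PacketModel.lnνLp, ← mul_neg, ← Finset.sum_neg_distrib]
  congr 1
  refine Finset.sum_congr rfl fun i _ => ?_
  rw [PacketModel.lnνTensorPower, ← Finset.sum_neg_distrib]
  refine Finset.sum_congr rfl fun e _ => ?_
  rw [M.region_succ t i p e, M.logμ_peel_O, hθ, neg_mul]

/-- **What every hull-volume estimate must dominate.** If `δ` bounds the discrepancy of the hull of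
`U_Θ` against the bare region, `ln ν̄_𝕃(hull(U_Θ)) ≤ ln ν̄_𝕃(O_𝕃(−div t)) + δ` (the shape of abc-iut-S2's
`EstimateDH δ` / [IUTchIV] Thm. 1.10 Steps (v)–(viii)), then
`Σ_{p∈T}(1/ℓ⋇)Σ_jΣ_{v⃗}(θ_j(v⃗(j)) − min_k θ_j(v⃗(k)))·Π_k Pr(v⃗(k)) ≤ δ`: the (Ind1) slot residue is a LOWER
bound for every such `δ`, whatever the estimate. [cite: DupuyHilado2025, §4.7, §4.11, §4.12] -/
theorem slotResidue_le_of_hull_le (hθ : ∀ i p v, M.lnAbs (t i p v) = -θ i p v)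
    (hH : M.RegionAdm (M.hullUTheta D)) (T : Finset ℕ) {δ : ℝ}
    (hδ : M.lnνL lstar T (M.hullUTheta D) ≤ M.lnνL lstar T (M.region t) + δ) :
    (∑ p ∈ T, (1 / (lstar : ℝ)) * ∑ i : Fin lstar, ∑ e : Fin ((i : ℕ) + 1 + 1) → placesOver F p,
        θ i p (e (Fin.last _)) * ∏ k, weight F (e k).1) -
      (∑ p ∈ T, (1 / (lstar : ℝ)) * ∑ i : Fin lstar, ∑ e : Fin ((i : ℕ) + 1 + 1) → placesOver F p,
        Finset.univ.inf' Finset.univ_nonempty (fun k => θ i p (e k)) * ∏ k, weight F (e k).1) ≤ δ := by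
  have h1 := M.neg_slotMin_le_lnνL_hullUTheta D θ hθ hH T
  rw [M.lnνL_region_eq_neg_lastSlot θ hθ T] at hδ
  linarith

end IndPacketModel

end Literature.IUT.LogVolume

end
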